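import Mathlib
import HarnessLib
import Literature.MathematicalPhysics.StatisticalMechanics.RenormalisationMapBlockTerm
import Literature.MathematicalPhysics.StatisticalMechanics.RenormalisationMapBlockBracket
import Literature.MathematicalPhysics.StatisticalMechanics.NextHamiltonianBoundsQ
import Literature.MathematicalPhysics.StatisticalMechanics.FluctuationDefectQ

/-!
# The single-block term `R^{(q)}_{k+1}K(B) − H̃(B)` and the block bracket of `S_k` for step data with
# a kernel BY PREDICATE ([ABKM19] Theorem 6.8 / Lemma 10.6, `q ∈ B_κ`)

`RenormalisationMapBlockTerm` (`contDiff_blockTerm_abkm`, `blockTerm_sub_abkm`, `tayNormLE_blockTerm_abkm`,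
`tayNormLE_blockTerm_sub_abkm`) and `RenormalisationMapBlockBracket` (`isGaugeLocal_blockBracket_abkm`,
`contDiff_blockBracket_abkm`, `tayNormLE_blockBracket_abkm`, `tayNormLE_blockBracket_sub_abkm`) are
stated for the step kernel EQUAL to the weight kernel `𝒞_{k+1}` (`q = 0`).  Of the kernel the proofs
use only what `StepKernelBounds` records (integration property, smoothness/integrability of
`R_{k+1}F`, `circulant ⪰ 0`) and the shift bound `L^{dk}|γ_q| ≤ h²` (hypothesis).  This file is their
`q`-twin for step data / kernels with `StepKernelBounds W L k A𝒫' C₂ ·` relative to the `q = 0`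
weights (constant `A_𝒫 ↦ A𝒫'`, `C₂ ≤ h²` in place of the regularity-constant hypothesis where the
shift bound was derived):

* `contDiff_blockTerm_abkm_of_stepKernelBounds`, `blockTerm_sub_abkm_of_stepKernelBounds`,
  **`tayNormLE_blockTerm_abkm_of_stepKernelBounds`**, **`tayNormLE_blockTerm_sub_abkm_of_stepKernelBounds`**;
* `isGaugeLocal_blockBracket_abkm_of_stepKernelBounds` (any kernel), `contDiff_blockBracket_abkm_of_stepKernelBounds`,
  **`tayNormLE_blockBracket_abkm_of_stepKernelBounds`**, **`tayNormLE_blockBracket_sub_abkm_of_stepKernelBounds`**.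

The `q = 0` statements are recovered with `AbkmWeightBounds.stepKernelBounds`.  Everything is proved;
no named fact.

## References
* S. Adams, S. Buchholz, R. Kotecký, S. Müller, arXiv:1910.13564, Theorem 6.8 ((6.56)–(6.64)),
  Lemma 10.6, Lemma 7.7 [AdamsBuchholzKoteckyMuller2019].
-/

noncomputable section

namespace Literature.MathematicalPhysics.StatisticalMechanics.GradientRG

open scoped BigOperators Classical
open Finset MeasureTheory
open Literature.MathematicalPhysics.QuantumFieldTheory
open Literature.MathematicalPhysics.StatisticalMechanics.TorusPolymer
  (IsPolymer blockOf thicken boxCorner isPolymer_blockOf card_blockOf subset_thicken blocks_blockOf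
    card_blocks_eq_numBlocks numBlocks)
open Literature.Barriers.CriticalPhenomena.LongRangePhi4.Polymer (IsConn)

variable {d M : ℕ} [NeZero M]

/-- **`blockTerm` is `C^{r₀}`** for the torus data and `‖K‖_k^{(A)} ≤ C` (`A > 0`).
[cite: AdamsBuchholzKoteckyMuller2019, Ch. 10.1 (10.4) / Lemma 8.4] -/
theorem contDiff_blockTerm_abkm_of_stepKernelBounds {L N Mord R n p r₀ : ℕ} {θbar lam μ δ₁ δ₀ A𝒫 A𝒫' C₂ h A : ℝ}
    {𝒞 : ℕ → (Fin d → ZMod M) → ℝ}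
    (hB : AbkmWeightBounds L N Mord R n θbar lam μ δ₁ δ₀ A𝒫 𝒞
      (abkmWeightData L N Mord R θbar (schedDelta δ₀ δ₁ N) 𝒞))
    (hLodd : Odd L) (hM : M = L ^ N) {k : ℕ} (hA : 0 < A)
    (D : StepData d M) (hS : StepKernelBounds (abkmWeightData L N Mord R θbar (schedDelta δ₀ δ₁ N) 𝒞) L k A𝒫' C₂ D.𝒞) (x : Fin d → ZMod M)
    {K : Finset (Fin d → ZMod M) → ((Fin d → ZMod M) → ℝ) → ℂ} {C : ℝ} (hC : 0 ≤ C)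
    (hK : WeakNormLE (abkmNormParams L N Mord R p r₀ h θbar A (schedDelta δ₀ δ₁ N) 𝒞) k K C)
    (hKd : ∀ X, ContDiff ℝ r₀ (K X))
    (hKloc : ∀ X, IsPolymer (L ^ k) X → IsConn X →
      IsGaugeLocal ((abkmNormParams L N Mord R p r₀ h θbar A (schedDelta δ₀ δ₁ N) 𝒞).gauge k X) (K X)) :
    ContDiff ℝ r₀ (blockTerm D K (blockOf (L ^ k) x)) := by
  have hMo : Odd M := by rw [hM]; exact hLodd.pow
  have h1 : ContDiff ℝ r₀ (fluct D.𝒞 (K (blockOf (L ^ k) x))) := by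
    exact contDiff_fluct_of_weakNormLE_of_stepKernelBounds hB hS hA hC hK hKd hKloc (isPolymer_blockOf _ x)
      (TorusPolymer.isConn_blockOf hMo hLodd.pow x)
  show ContDiff ℝ r₀ (fun φ => fluct D.𝒞 (K (blockOf (L ^ k) x)) φ + eval (opB D K) (blockOf (L ^ k) x) φ)
  exact h1.add (contDiff_eval _ _)

/-- **`blockTerm` is additive in `K`** (difference form, torus data; `R_{k+1}` and `B_k` are additive
on activities with finite weak norm): `blockTerm D K B − blockTerm D K' B = blockTerm D (K − K') B`.
[cite: AdamsBuchholzKoteckyMuller2019, Theorem 6.8 (C_k is linear)] -/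
theorem blockTerm_sub_abkm_of_stepKernelBounds {L N Mord R n p r₀ : ℕ} {θbar lam μ δ₁ δ₀ A𝒫 A𝒫' C₂ h A : ℝ}
    {𝒞 : ℕ → (Fin d → ZMod M) → ℝ}
    (hB : AbkmWeightBounds L N Mord R n θbar lam μ δ₁ δ₀ A𝒫 𝒞
      (abkmWeightData L N Mord R θbar (schedDelta δ₀ δ₁ N) 𝒞))
    {k : ℕ} (hr₀ : 2 ≤ r₀) (hLodd : Odd L) (hM : M = L ^ N) (hA : 0 < A)
    (D : StepData d M) (hS : StepKernelBounds (abkmWeightData L N Mord R θbar (schedDelta δ₀ δ₁ N) 𝒞) L k A𝒫' C₂ D.𝒞) {x₀ : Fin d → ZMod M} (hB₀ : D.B₀ = blockOf (L ^ k) x₀)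
    (x : Fin d → ZMod M)
    {K K' : Finset (Fin d → ZMod M) → ((Fin d → ZMod M) → ℝ) → ℂ} {C C' : ℝ} (hC : 0 ≤ C) (hC' : 0 ≤ C')
    (hK : WeakNormLE (abkmNormParams L N Mord R p r₀ h θbar A (schedDelta δ₀ δ₁ N) 𝒞) k K C)
    (hK' : WeakNormLE (abkmNormParams L N Mord R p r₀ h θbar A (schedDelta δ₀ δ₁ N) 𝒞) k K' C')
    (hKd : ∀ X, ContDiff ℝ r₀ (K X)) (hK'd : ∀ X, ContDiff ℝ r₀ (K' X))
    (hKloc : ∀ X, IsPolymer (L ^ k) X → IsConn X →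
      IsGaugeLocal ((abkmNormParams L N Mord R p r₀ h θbar A (schedDelta δ₀ δ₁ N) 𝒞).gauge k X) (K X))
    (hK'loc : ∀ X, IsPolymer (L ^ k) X → IsConn X →
      IsGaugeLocal ((abkmNormParams L N Mord R p r₀ h θbar A (schedDelta δ₀ δ₁ N) 𝒞).gauge k X) (K' X)) :
    (fun φ => blockTerm D K (blockOf (L ^ k) x) φ - blockTerm D K' (blockOf (L ^ k) x) φ) =
      blockTerm D (K - K') (blockOf (L ^ k) x) := by
  set P := abkmNormParams L N Mord R p r₀ h θbar A (schedDelta δ₀ δ₁ N) 𝒞 with hP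
  set B := blockOf (L ^ k) x with hBdef
  have hMo : Odd M := by rw [hM]; exact hLodd.pow
  have hPB : IsPolymer (L ^ k) B := isPolymer_blockOf _ x
  have hcB : IsConn B := TorusPolymer.isConn_blockOf hMo hLodd.pow x
  have hCn : 0 ≤ C * P.aFactor k B := mul_nonneg hC (WeakNormLE.aFactor_pos hA k _).le
  have hC'n : 0 ≤ C' * P.aFactor k B := mul_nonneg hC' (WeakNormLE.aFactor_pos hA k _).le
  have hdom := hS.weightSectionDominated hB.dominated B (P.gauge k B)
  have hiK : ∀ φ, Integrable (fun ξ => K B (φ + ξ)) (stepMeasure D.𝒞) := fun φ => by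
    exact integrable_comp_add_of_tayNormLE (hK B hPB hcB) hCn (hKd _) (hKloc _ hPB hcB) hdom φ
  have hiK' : ∀ φ, Integrable (fun ξ => K' B (φ + ξ)) (stepMeasure D.𝒞) := fun φ => by
    exact integrable_comp_add_of_tayNormLE (hK' B hPB hcB) hC'n (hK'd _) (hK'loc _ hPB hcB) hdom φ
  have hfl : fluct D.𝒞 (K B) - fluct D.𝒞 (K' B) = fluct D.𝒞 ((K - K') B) := by
    rw [show (K - K') B = K B - K' B from rfl]; exact (fluct_sub_of_integrable hiK hiK').symm
  have hop := opB_sub_abkm_of_stepKernelBounds hB hr₀ hLodd hM hA D hS hB₀ hC hC' hK hK' hKd hK'd hKloc hK'loc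
  funext φ
  show fluct D.𝒞 (K B) φ + eval (opB D K) B φ - (fluct D.𝒞 (K' B) φ + eval (opB D K') B φ) =
    fluct D.𝒞 ((K - K') B) φ + eval (opB D (K - K')) B φ
  rw [← hop, eval_sub, ← hfl, Pi.sub_apply]
  ring

/-- **Size of `blockTerm` in the slot norm** ([ABKM19] Ch. 10.1 with Lemma 8.4, Lemma 8.9 (strong form)
and Lemma 10.6): torus data at scale `k` (`d ≥ 2`, `L` odd, `L ≥ 2^{d+3}+16R`, `M = L^N`, `k+1 ≤ N`,
`p ≤ R`, `⌊d/2⌋+1 ≤ min(p, M_ord)`, `r₀ ≥ 2`, `θ̄, λ, δ₀, δ₁ > 0`, `h² ≥ h₀²`, `A ≥ 1`, step data with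
`D.𝒞 = 𝒞_{k+1}`, reference block `B_{x₀}` and its box corner), `‖K‖_k^{(A)} ≤ C`, `C^{r₀}`, local: on any block
`B = B_x`, `|blockTerm D K B|_{T_k^{B*}, w_{k:k+1}^B} ≤ (1 + 8C_{8.7})·(C A_𝒫 A^{−1})`.
[cite: AdamsBuchholzKoteckyMuller2019, Ch. 10.1 (10.4) / Lemma 10.6] -/
theorem tayNormLE_blockTerm_abkm_of_stepKernelBounds {L N Mord R n p r₀ : ℕ} {θbar lam μ δ₁ δ₀ A𝒫 A𝒫' C₂ h A : ℝ}
    {𝒞 : ℕ → (Fin d → ZMod M) → ℝ} (hd : 2 ≤ d) (hLodd : Odd L) (hL : 2 ^ (d + 3) + 16 * R ≤ L)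
    (hM : M = L ^ N) {k : ℕ} (hkN : k + 1 ≤ N) (hp : d / 2 + 1 ≤ p) (hpR : p ≤ R) (hMord : d / 2 + 1 ≤ Mord)
    (hr₀ : 2 ≤ r₀)
    (hB : AbkmWeightBounds L N Mord R n θbar lam μ δ₁ δ₀ A𝒫 𝒞
      (abkmWeightData L N Mord R θbar (schedDelta δ₀ δ₁ N) 𝒞))
    (hδ₀ : 0 < δ₀) (hδ₁ : 0 < δ₁) (hh : 0 < h) (hh0 : hZeroSq d R δ₀ δ₁ ≤ h ^ 2) (hA : 1 ≤ A)
    (D : StepData d M) (hS : StepKernelBounds (abkmWeightData L N Mord R θbar (schedDelta δ₀ δ₁ N) 𝒞) L k A𝒫' C₂ D.𝒞) {x₀ : Fin d → ZMod M} (hB₀ : D.B₀ = blockOf (L ^ k) x₀)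
    (hc₀ : D.c₀ = boxCorner (L ^ k) (starRad R L d k) x₀) (x : Fin d → ZMod M)
    {K : Finset (Fin d → ZMod M) → ((Fin d → ZMod M) → ℝ) → ℂ} {C : ℝ} (hC : 0 ≤ C)
    (hK : WeakNormLE (abkmNormParams L N Mord R p r₀ h θbar A (schedDelta δ₀ δ₁ N) 𝒞) k K C)
    (hKd : ∀ X, ContDiff ℝ r₀ (K X))
    (hKloc : ∀ X, IsPolymer (L ^ k) X → IsConn X →
      IsGaugeLocal ((abkmNormParams L N Mord R p r₀ h θbar A (schedDelta δ₀ δ₁ N) 𝒞).gauge k X) (K X)) :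
    TayNormLE ((abkmNormParams L N Mord R p r₀ h θbar A (schedDelta δ₀ δ₁ N) 𝒞).gauge k (blockOf (L ^ k) x))
      r₀ ((abkmWeightData L N Mord R θbar (schedDelta δ₀ δ₁ N) 𝒞).midWeight k (blockOf (L ^ k) x))
      (blockTerm D K (blockOf (L ^ k) x))
      ((1 + 8 * pi2BoundConst d (((2 * R + 2 : ℕ) : ℝ) + ((d / 2 + 1 : ℕ) : ℝ))) * (C * A𝒫' * A⁻¹)) := by
  set P := abkmNormParams L N Mord R p r₀ h θbar A (schedDelta δ₀ δ₁ N) 𝒞 with hP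
  set W := abkmWeightData L N Mord R θbar (schedDelta δ₀ δ₁ N) 𝒞 with hW
  set B := blockOf (L ^ k) x with hBdef
  set C87 := pi2BoundConst d (((2 * R + 2 : ℕ) : ℝ) + ((d / 2 + 1 : ℕ) : ℝ)) with hC87
  have hL0 : (0 : ℝ) < L := by exact_mod_cast hLodd.pos
  have hA0 : 0 < A := by linarith
  have hk' : k + 1 ≤ N + 1 := by omega
  have hk : k ≤ N := by omega
  obtain ⟨t, ht⟩ : ∃ t, N = k + t := ⟨N - k, by omega⟩
  have hMt : M = L ^ k * L ^ t := by rw [← pow_add, ← ht]; exact hM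
  have hMo : Odd M := by rw [hM]; exact hLodd.pow
  have hcard : B.card = L ^ (d * k) := by
    rw [hBdef, card_blockOf hMt hLodd.pow hLodd.pow x, ← pow_mul, mul_comm]
  have h𝔥 : 0 < fieldWt h (L : ℝ) d k := fieldWt_pos hh hL0 d k
  have hRk : (0 : ℝ) < (L : ℝ) ^ k := by positivity
  have hBS : B ⊆ thicken (P.rad k) B := subset_thicken _ _
  have hgauge : P.gauge k B = fieldGauge (fieldWt h (L : ℝ) d k) ((L : ℝ) ^ k) p (thicken (P.rad k) B) := rfl
  have hPB : IsPolymer (L ^ k) B := isPolymer_blockOf _ x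
  have hcB : IsConn B := TorusPolymer.isConn_blockOf hMo hLodd.pow x
  have hnB : numBlocks (L ^ k) B = 1 := by
    rw [← card_blocks_eq_numBlocks, hBdef, blocks_blockOf, card_singleton]
  have haF : P.aFactor k B = A⁻¹ := by
    show (A ^ numBlocks (L ^ k) B)⁻¹ = A⁻¹; rw [hnB, pow_one]
  have hC87_0 : 0 ≤ C87 := pi2BoundConst_nonneg d (by positivity)
  -- (i) `R_{k+1}K(B)`
  have hKB : TayNormLE (P.gauge k B) r₀ (W.weight k B) (K B) (C * A⁻¹) := by
    have h1 := hK B hPB hcB; rw [haF] at h1; exact h1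
  have hc1 : 0 ≤ C * A⁻¹ := by positivity
  have hR : TayNormLE (P.gauge k B) r₀ (W.midWeight k B) (fluct D.𝒞 (K B)) (C * A⁻¹ * A𝒫') := by
    have h1 := hS.tayNormLE_fluct hB.dominated hPB (P.gauge k B) hc1 (hKd B) (hKloc B hPB hcB) hKB
    rw [hnB, pow_one] at h1
    exact h1
  have hRd : ContDiff ℝ r₀ (fluct D.𝒞 (K B)) := by
    exact contDiff_fluct_of_weakNormLE_of_stepKernelBounds hB hS hA0 hC hK hKd hKloc hPB hcB
  -- (ii) `(B_kK)(B)` in the strong norm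
  have hSW : ∀ φ, expWeight (strongCoef h N k • derivForm (L : ℝ) k (diffIndex d Mord)
      (boxDensity (boxRad R L k) (boxWt (L : ℝ) d k) B)) φ ≤ W.weight k B φ :=
    fun φ => strongWeight_le_weight_abkm hB hδ₀ hδ₁ hh hh0 k (subset_refl B) φ
  have hwm : ∀ φ, W.weight k B φ ≤ W.midWeight k B φ := fun φ =>
    WeightData.weight_le_midWeight hB.dominated k B φ
  have hev_s := tayNormLE_eval_strong_abkm (R := R) (Mord := Mord) hd hLodd hM hk hh hMord hp hBS (opB D K) r₀
  rw [← hgauge, hcard] at hev_s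
  have hopB := hamNorm_opB_abkm_le_scale_of_stepKernelBounds hLodd hL hM hkN hpR hr₀ hB hh hA D hS hB₀ hc₀ hC hK hKd
    hKloc
  have hn0 : 0 ≤ hamNorm (fieldWt h (L : ℝ) d k) ((L : ℝ) ^ k) (L ^ (d * k)) (opB D K) :=
    hamNorm_nonneg h𝔥.le hRk.le _ _
  have hc2 : 0 ≤ 8 * hamNorm (fieldWt h (L : ℝ) d k) ((L : ℝ) ^ k) (L ^ (d * k)) (opB D K) := by positivity
  have hE : TayNormLE (P.gauge k B) r₀ (W.midWeight k B) (fun φ : (Fin d → ZMod M) → ℝ => eval (opB D K) B φ)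
      (8 * (C87 * (C * A𝒫' * A⁻¹))) :=
    (((hev_s.mono_weight hc2 hSW).mono_weight hc2 hwm).mono (by nlinarith) fun φ => (W.midWeight_pos k B φ).le)
  -- combine
  have heq : blockTerm D K B = fluct D.𝒞 (K B) + fun φ : (Fin d → ZMod M) → ℝ => eval (opB D K) B φ := by
    funext φ; rfl
  rw [heq]
  refine ((hR.add hE hRd (contDiff_eval _ _)).mono ?_ fun φ => (W.midWeight_pos k B φ).le)
  ring_nf
  rfl

/-- **Lipschitz bound of `blockTerm` in the slot norm**: with the data of `tayNormLE_blockTerm_abkm_of_stepKernelBounds` for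
`K` and `K'` (`‖K‖, ‖K'‖ ≤ C`) and `‖K − K'‖_k^{(A)} ≤ C_Δ`:
`|blockTerm D K B − blockTerm D K' B|_{T_k^{B*}, w_{k:k+1}^B} ≤ (1 + 8C_{8.7})·(C_Δ A_𝒫 A^{−1})`.
[cite: AdamsBuchholzKoteckyMuller2019, Ch. 10.1 (10.4) / Lemma 10.6] -/
theorem tayNormLE_blockTerm_sub_abkm_of_stepKernelBounds {L N Mord R n p r₀ : ℕ} {θbar lam μ δ₁ δ₀ A𝒫 A𝒫' C₂ h A : ℝ}
    {𝒞 : ℕ → (Fin d → ZMod M) → ℝ} (hd : 2 ≤ d) (hLodd : Odd L) (hL : 2 ^ (d + 3) + 16 * R ≤ L)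
    (hM : M = L ^ N) {k : ℕ} (hkN : k + 1 ≤ N) (hp : d / 2 + 1 ≤ p) (hpR : p ≤ R) (hMord : d / 2 + 1 ≤ Mord)
    (hr₀ : 2 ≤ r₀)
    (hB : AbkmWeightBounds L N Mord R n θbar lam μ δ₁ δ₀ A𝒫 𝒞
      (abkmWeightData L N Mord R θbar (schedDelta δ₀ δ₁ N) 𝒞))
    (hδ₀ : 0 < δ₀) (hδ₁ : 0 < δ₁) (hh : 0 < h) (hh0 : hZeroSq d R δ₀ δ₁ ≤ h ^ 2) (hA : 1 ≤ A)
    (D : StepData d M) (hS : StepKernelBounds (abkmWeightData L N Mord R θbar (schedDelta δ₀ δ₁ N) 𝒞) L k A𝒫' C₂ D.𝒞) {x₀ : Fin d → ZMod M} (hB₀ : D.B₀ = blockOf (L ^ k) x₀)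
    (hc₀ : D.c₀ = boxCorner (L ^ k) (starRad R L d k) x₀) (x : Fin d → ZMod M)
    {K K' : Finset (Fin d → ZMod M) → ((Fin d → ZMod M) → ℝ) → ℂ} {C CΔ : ℝ} (hC : 0 ≤ C) (hCΔ : 0 ≤ CΔ)
    (hK : WeakNormLE (abkmNormParams L N Mord R p r₀ h θbar A (schedDelta δ₀ δ₁ N) 𝒞) k K C)
    (hK' : WeakNormLE (abkmNormParams L N Mord R p r₀ h θbar A (schedDelta δ₀ δ₁ N) 𝒞) k K' C)
    (hΔ : WeakNormLE (abkmNormParams L N Mord R p r₀ h θbar A (schedDelta δ₀ δ₁ N) 𝒞) k (K - K') CΔ)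
    (hKd : ∀ X, ContDiff ℝ r₀ (K X)) (hK'd : ∀ X, ContDiff ℝ r₀ (K' X))
    (hKloc : ∀ X, IsPolymer (L ^ k) X → IsConn X →
      IsGaugeLocal ((abkmNormParams L N Mord R p r₀ h θbar A (schedDelta δ₀ δ₁ N) 𝒞).gauge k X) (K X))
    (hK'loc : ∀ X, IsPolymer (L ^ k) X → IsConn X →
      IsGaugeLocal ((abkmNormParams L N Mord R p r₀ h θbar A (schedDelta δ₀ δ₁ N) 𝒞).gauge k X) (K' X)) :
    TayNormLE ((abkmNormParams L N Mord R p r₀ h θbar A (schedDelta δ₀ δ₁ N) 𝒞).gauge k (blockOf (L ^ k) x))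
      r₀ ((abkmWeightData L N Mord R θbar (schedDelta δ₀ δ₁ N) 𝒞).midWeight k (blockOf (L ^ k) x))
      (fun φ => blockTerm D K (blockOf (L ^ k) x) φ - blockTerm D K' (blockOf (L ^ k) x) φ)
      ((1 + 8 * pi2BoundConst d (((2 * R + 2 : ℕ) : ℝ) + ((d / 2 + 1 : ℕ) : ℝ))) * (CΔ * A𝒫' * A⁻¹)) := by
  have hA0 : 0 < A := by linarith
  have hk' : k + 1 ≤ N + 1 := by omega
  have hKΔd : ∀ X, ContDiff ℝ r₀ ((K - K') X) := fun X => by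
    show ContDiff ℝ r₀ (K X - K' X); exact (hKd X).sub (hK'd X)
  have hKΔloc : ∀ X, IsPolymer (L ^ k) X → IsConn X →
      IsGaugeLocal ((abkmNormParams L N Mord R p r₀ h θbar A (schedDelta δ₀ δ₁ N) 𝒞).gauge k X) ((K - K') X) :=
    fun X hX hc φ ψ e => by
      show (K X - K' X) φ = (K X - K' X) ψ
      simp only [Pi.sub_apply]
      rw [hKloc X hX hc φ ψ e, hK'loc X hX hc φ ψ e]
  rw [blockTerm_sub_abkm_of_stepKernelBounds hB hr₀ hLodd hM hA0 D hS hB₀ x hC hC hK hK' hKd hK'd hKloc hK'loc]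
  exact tayNormLE_blockTerm_abkm_of_stepKernelBounds hd hLodd hL hM hkN hp hpR hMord hr₀ hB hδ₀ hδ₁ hh hh0 hA D hS
    hB₀ hc₀ x hCΔ hΔ hKΔd hKΔloc

/-- **The block bracket is local** for `T_k^{B*}` (any `H, V`; the fluctuation integral preserves
locality). [cite: AdamsBuchholzKoteckyMuller2019, Theorem 6.8 / Lemma 6.4 (2)] -/
theorem isGaugeLocal_blockBracket_abkm_of_stepKernelBounds {L N Mord R p r₀ : ℕ} {θbar h A : ℝ} {δ' : ℕ → ℝ}
    {𝒞 : ℕ → (Fin d → ZMod M) → ℝ} (hLodd : Odd L) (hh : 0 < h) (hp : d / 2 + 1 ≤ p) (k : ℕ)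
    {𝒞q : (Fin d → ZMod M) → ℝ} (x : Fin d → ZMod M) (H V : RelevantHamiltonian ℂ d) :
    IsGaugeLocal ((abkmNormParams L N Mord R p r₀ h θbar A δ' 𝒞).gauge k (blockOf (L ^ k) x))
      (fun φ => fluctDefect 𝒞q H (blockOf (L ^ k) x) φ +
        (expNegH (stepOpA (gradCov 𝒞q) H) (blockOf (L ^ k) x) φ - 1) *
          (1 - Complex.exp (-(eval V (blockOf (L ^ k) x) φ))) -
        (Complex.exp (-(eval V (blockOf (L ^ k) x) φ)) - 1 + eval V (blockOf (L ^ k) x) φ)) := by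
  set P := abkmNormParams L N Mord R p r₀ h θbar A δ' 𝒞 with hP
  set B := blockOf (L ^ k) x with hBdef
  have hL0 : (0 : ℝ) < L := by exact_mod_cast hLodd.pos
  have h𝔥 : 0 < fieldWt h (L : ℝ) d k := fieldWt_pos hh hL0 d k
  have hRk : (0 : ℝ) < (L : ℝ) ^ k := by positivity
  have hBS : B ⊆ thicken (P.rad k) B := subset_thicken _ _
  have hgauge : P.gauge k B = fieldGauge (fieldWt h (L : ℝ) d k) ((L : ℝ) ^ k) p (thicken (P.rad k) B) := rfl
  have hev : ∀ G : RelevantHamiltonian ℂ d, IsGaugeLocal (P.gauge k B)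
      (fun φ : (Fin d → ZMod M) → ℝ => eval G B φ) := fun G => by
    rw [hgauge]; exact isGaugeLocal_eval h𝔥.ne' hRk.ne' hp hBS G
  have hexp_loc : ∀ G : RelevantHamiltonian ℂ d, IsGaugeLocal (P.gauge k B) (expNegH G B) :=
    fun G φ ψ hT => by simp only [expNegH, hev G φ ψ hT]
  have hfl : IsGaugeLocal (P.gauge k B) (fluct 𝒞q (expNegH H B)) :=
    isGaugeLocal_fluct _ _ (hexp_loc H)
  intro φ ψ hT
  have e2 := hev (stepOpA (gradCov 𝒞q) H) φ ψ hT
  have e3 := hev V φ ψ hT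
  simp only at e2 e3
  simp only [fluctDefect, expNegH]
  rw [hfl φ ψ hT, e2, e3]

/-- **The block bracket is `C^{r₀}`** for the torus tower (`‖H‖_{k,0} ≤ 1/8`, needed to differentiate
the fluctuation integral of `e^{−H(B)}` under the integral sign).
[cite: AdamsBuchholzKoteckyMuller2019, Theorem 6.8 / Lemma 8.4] -/
theorem contDiff_blockBracket_abkm_of_stepKernelBounds {L N Mord R n p r₀ : ℕ} {θbar lam μ δ₁ δ₀ A𝒫 A𝒫' C₂ h A : ℝ}
    {𝒞 : ℕ → (Fin d → ZMod M) → ℝ} (hd : 2 ≤ d)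
    (hB : AbkmWeightBounds L N Mord R n θbar lam μ δ₁ δ₀ A𝒫 𝒞
      (abkmWeightData L N Mord R θbar (schedDelta δ₀ δ₁ N) 𝒞))
    (hLodd : Odd L) (hM : M = L ^ N) {k : ℕ} (hk : k ≤ N)
    {𝒞q : (Fin d → ZMod M) → ℝ} (hS : StepKernelBounds (abkmWeightData L N Mord R θbar (schedDelta δ₀ δ₁ N) 𝒞) L k A𝒫' C₂ 𝒞q) (hδ₀ : 0 < δ₀) (hδ₁ : 0 < δ₁) (hh : 0 < h)
    (hh0 : hZeroSq d R δ₀ δ₁ ≤ h ^ 2) (hMord : d / 2 + 1 ≤ Mord) (hp : d / 2 + 1 ≤ p)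
    (x : Fin d → ZMod M) {H : RelevantHamiltonian ℂ d} (V : RelevantHamiltonian ℂ d)
    (hH : hamNorm (fieldWt h (L : ℝ) d k) ((L : ℝ) ^ k) (L ^ (d * k)) H ≤ 1 / 8) :
    ContDiff ℝ r₀
      (fun φ => fluctDefect 𝒞q H (blockOf (L ^ k) x) φ +
        (expNegH (stepOpA (gradCov 𝒞q) H) (blockOf (L ^ k) x) φ - 1) *
          (1 - Complex.exp (-(eval V (blockOf (L ^ k) x) φ))) -
        (Complex.exp (-(eval V (blockOf (L ^ k) x) φ)) - 1 + eval V (blockOf (L ^ k) x) φ)) := by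
  set P := abkmNormParams L N Mord R p r₀ h θbar A (schedDelta δ₀ δ₁ N) 𝒞 with hP
  set W := abkmWeightData L N Mord R θbar (schedDelta δ₀ δ₁ N) 𝒞 with hW
  set B := blockOf (L ^ k) x with hBdef
  have hL0 : (0 : ℝ) < L := by exact_mod_cast hLodd.pos
  have hk' : k + 1 ≤ N + 1 := by omega
  obtain ⟨t, ht⟩ : ∃ t, N = k + t := ⟨N - k, by omega⟩
  have hMt : M = L ^ k * L ^ t := by rw [← pow_add, ← ht]; exact hM
  have hcard : B.card = L ^ (d * k) := by
    rw [hBdef, card_blockOf hMt hLodd.pow hLodd.pow x, ← pow_mul, mul_comm]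
  have h𝔥 : 0 < fieldWt h (L : ℝ) d k := fieldWt_pos hh hL0 d k
  have hRk : (0 : ℝ) < (L : ℝ) ^ k := by positivity
  have hBS : B ⊆ thicken (P.rad k) B := subset_thicken _ _
  have hgauge : P.gauge k B = fieldGauge (fieldWt h (L : ℝ) d k) ((L : ℝ) ^ k) p (thicken (P.rad k) B) := rfl
  have hSW : ∀ φ, expWeight (strongCoef h N k • derivForm (L : ℝ) k (diffIndex d Mord)
      (boxDensity (boxRad R L k) (boxWt (L : ℝ) d k) B)) φ ≤ W.weight k B φ :=
    fun φ => strongWeight_le_weight_abkm hB hδ₀ hδ₁ hh hh0 k (subset_refl B) φ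
  have hev : ∀ G : RelevantHamiltonian ℂ d, IsGaugeLocal (P.gauge k B)
      (fun φ : (Fin d → ZMod M) → ℝ => eval G B φ) := fun G => by
    rw [hgauge]; exact isGaugeLocal_eval h𝔥.ne' hRk.ne' hp hBS G
  have hexp_loc : ∀ G : RelevantHamiltonian ℂ d, IsGaugeLocal (P.gauge k B) (expNegH G B) :=
    fun G φ ψ hT => by simp only [expNegH, hev G φ ψ hT]
  have hexp_d : ∀ G : RelevantHamiltonian ℂ d, ContDiff ℝ r₀ (expNegH G B) := fun G => by
    show ContDiff ℝ r₀ (fun φ : (Fin d → ZMod M) → ℝ => Complex.exp (-(eval G B φ)))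
    exact (contDiff_eval G B (n := r₀)).neg.cexp
  have hHB : hamNorm (fieldWt h (L : ℝ) d k) ((L : ℝ) ^ k) B.card H ≤ 1 / 8 := by rw [hcard]; exact hH
  have hs := tayNormLE_expNegH_strong_abkm (R := R) (Mord := Mord) hd hLodd hM hk hh hMord hp hBS r₀ hHB
  rw [← hgauge] at hs
  have h1 : ContDiff ℝ r₀ (fluct 𝒞q (expNegH H B)) :=
    hS.contDiff_fluct hB.dominated B (P.gauge k B) (Real.exp_pos _).le (hexp_d H) (hexp_loc H)
      (hs.mono_weight (Real.exp_pos _).le hSW)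
  have hD : ContDiff ℝ r₀ (fluctDefect 𝒞q H B) := by
    show ContDiff ℝ r₀ (fun φ => fluct 𝒞q (expNegH H B) φ - expNegH (stepOpA (gradCov 𝒞q) H) B φ)
    exact h1.sub (hexp_d _)
  have hV : ContDiff ℝ r₀ (fun φ : (Fin d → ZMod M) → ℝ => Complex.exp (-(eval V B φ))) :=
    (contDiff_eval V B (n := r₀)).neg.cexp
  exact (hD.add (((hexp_d _).sub contDiff_const).mul (contDiff_const.sub hV))).sub
    ((hV.sub contDiff_const).add (contDiff_eval V B))

/-- **The block bracket is of second order**: on `B = B_x` at scale `k ≤ N` (torus data as in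
`tayNormLE_fluctDefect_abkm_of_stepKernelBounds`: `d ≥ 2`, `L` odd, `M = L^N`, `θ̄, λ, δ₀, δ₁ > 0`, `h² ≥ h₀²`,
`⌊d/2⌋+1 ≤ min(p, M_ord)`, shift `L^{dk}|γ_q| ≤ h²`), for `‖H‖_{k,0} ≤ 1/32`, `‖V‖_{k,0} ≤ 1/16`:
`|Φ_B(H,V)|_{T_k^{B*}, w_{k:k+1}^B} ≤ 256e^{1/4}((A_𝒫 + 4)‖H‖² + 2‖H‖‖V‖ + ‖V‖²)`.
[cite: AdamsBuchholzKoteckyMuller2019, Theorem 6.8 ((6.56), (6.61)–(6.64))] -/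
theorem tayNormLE_blockBracket_abkm_of_stepKernelBounds {L N Mord R n p r₀ : ℕ} {θbar lam μ δ₁ δ₀ A𝒫 A𝒫' C₂ h A : ℝ}
    {𝒞 : ℕ → (Fin d → ZMod M) → ℝ} (hd : 2 ≤ d)
    (hB : AbkmWeightBounds L N Mord R n θbar lam μ δ₁ δ₀ A𝒫 𝒞
      (abkmWeightData L N Mord R θbar (schedDelta δ₀ δ₁ N) 𝒞))
    (hLodd : Odd L) (hM : M = L ^ N) {k : ℕ} (hk : k ≤ N)
    {𝒞q : (Fin d → ZMod M) → ℝ} (hS : StepKernelBounds (abkmWeightData L N Mord R θbar (schedDelta δ₀ δ₁ N) 𝒞) L k A𝒫' C₂ 𝒞q) (hδ₀ : 0 < δ₀) (hδ₁ : 0 < δ₁) (hh : 0 < h)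
    (hh0 : hZeroSq d R δ₀ δ₁ ≤ h ^ 2) (hMord : d / 2 + 1 ≤ Mord) (hp : d / 2 + 1 ≤ p)
    (hγ : ∀ q, ((L ^ (d * k) : ℕ) : ℝ) * |gradCov 𝒞q q| ≤ h ^ 2)
    (x : Fin d → ZMod M) {H V : RelevantHamiltonian ℂ d}
    (hH : hamNorm (fieldWt h (L : ℝ) d k) ((L : ℝ) ^ k) (L ^ (d * k)) H ≤ 1 / 32)
    (hV : hamNorm (fieldWt h (L : ℝ) d k) ((L : ℝ) ^ k) (L ^ (d * k)) V ≤ 1 / 16) :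
    TayNormLE ((abkmNormParams L N Mord R p r₀ h θbar A (schedDelta δ₀ δ₁ N) 𝒞).gauge k (blockOf (L ^ k) x))
      r₀ ((abkmWeightData L N Mord R θbar (schedDelta δ₀ δ₁ N) 𝒞).midWeight k (blockOf (L ^ k) x))
      (fun φ => fluctDefect 𝒞q H (blockOf (L ^ k) x) φ +
        (expNegH (stepOpA (gradCov 𝒞q) H) (blockOf (L ^ k) x) φ - 1) *
          (1 - Complex.exp (-(eval V (blockOf (L ^ k) x) φ))) -
        (Complex.exp (-(eval V (blockOf (L ^ k) x) φ)) - 1 + eval V (blockOf (L ^ k) x) φ))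
      (256 * Real.exp (1 / 4) *
        ((A𝒫' + 4) * hamNorm (fieldWt h (L : ℝ) d k) ((L : ℝ) ^ k) (L ^ (d * k)) H ^ 2 +
          2 * hamNorm (fieldWt h (L : ℝ) d k) ((L : ℝ) ^ k) (L ^ (d * k)) H *
            hamNorm (fieldWt h (L : ℝ) d k) ((L : ℝ) ^ k) (L ^ (d * k)) V +
          hamNorm (fieldWt h (L : ℝ) d k) ((L : ℝ) ^ k) (L ^ (d * k)) V ^ 2)) := by
  set P := abkmNormParams L N Mord R p r₀ h θbar A (schedDelta δ₀ δ₁ N) 𝒞 with hP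
  set W := abkmWeightData L N Mord R θbar (schedDelta δ₀ δ₁ N) 𝒞 with hW
  set B := blockOf (L ^ k) x with hBdef
  set 𝒸 := 𝒞q with h𝒸
  set AH := stepOpA (gradCov 𝒸) H with hAH
  set nH := hamNorm (fieldWt h (L : ℝ) d k) ((L : ℝ) ^ k) (L ^ (d * k)) H with hnH
  set nV := hamNorm (fieldWt h (L : ℝ) d k) ((L : ℝ) ^ k) (L ^ (d * k)) V with hnV
  have hL0 : (0 : ℝ) < L := by exact_mod_cast hLodd.pos
  have hL1 : 1 ≤ L := hLodd.pos
  obtain ⟨t, ht⟩ : ∃ t, N = k + t := ⟨N - k, by omega⟩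
  have hMt : M = L ^ k * L ^ t := by rw [← pow_add, ← ht]; exact hM
  have hcard : B.card = L ^ (d * k) := by
    rw [hBdef, card_blockOf hMt hLodd.pow hLodd.pow x, ← pow_mul, mul_comm]
  have h𝔥 : 0 < fieldWt h (L : ℝ) d k := fieldWt_pos hh hL0 d k
  have hRk : (0 : ℝ) < (L : ℝ) ^ k := by positivity
  have hnH0 : 0 ≤ nH := hamNorm_nonneg h𝔥.le hRk.le _ _
  have hnV0 : 0 ≤ nV := hamNorm_nonneg h𝔥.le hRk.le _ _
  have hAH2 : hamNorm (fieldWt h (L : ℝ) d k) ((L : ℝ) ^ k) (L ^ (d * k)) AH ≤ 2 * nH :=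
    hamNorm_stepOpA_abkm_le hd hL1 hh k hγ H
  have hnA0 : 0 ≤ hamNorm (fieldWt h (L : ℝ) d k) ((L : ℝ) ^ k) (L ^ (d * k)) AH :=
    hamNorm_nonneg h𝔥.le hRk.le _ _
  have hBS : B ⊆ thicken (P.rad k) B := subset_thicken _ _
  have hgauge : P.gauge k B = fieldGauge (fieldWt h (L : ℝ) d k) ((L : ℝ) ^ k) p (thicken (P.rad k) B) := rfl
  have hSW : ∀ φ, expWeight (strongCoef h N k • derivForm (L : ℝ) k (diffIndex d Mord)
      (boxDensity (boxRad R L k) (boxWt (L : ℝ) d k) B)) φ ≤ W.weight k B φ :=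
    fun φ => strongWeight_le_weight_abkm hB hδ₀ hδ₁ hh hh0 k (subset_refl B) φ
  have hwm : ∀ φ, W.weight k B φ ≤ W.midWeight k B φ := fun φ =>
    WeightData.weight_le_midWeight hB.dominated k B φ
  have hexp_d : ∀ G : RelevantHamiltonian ℂ d, ContDiff ℝ r₀ (expNegH G B) := fun G => by
    show ContDiff ℝ r₀ (fun φ : (Fin d → ZMod M) → ℝ => Complex.exp (-(eval G B φ)))
    exact (contDiff_eval G B (n := r₀)).neg.cexp
  have hsub1_d : ∀ G : RelevantHamiltonian ℂ d, ContDiff ℝ r₀ (fun φ => expNegH G B φ - 1) :=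
    fun G => (hexp_d G).sub contDiff_const
  -- (1) the defect
  have hD := tayNormLE_fluctDefect_abkm_of_stepKernelBounds (p := p) (r₀ := r₀) (A := A) hd hB hLodd hM hk hS hδ₀ hδ₁ hh
    hh0 hMord hp hγ x (H := H) (by linarith)
  have hD_d : ContDiff ℝ r₀ (fluctDefect 𝒸 H B) := by
    have hHB : hamNorm (fieldWt h (L : ℝ) d k) ((L : ℝ) ^ k) B.card H ≤ 1 / 8 := by rw [hcard]; linarith
    have hs := tayNormLE_expNegH_strong_abkm (R := R) (Mord := Mord) hd hLodd hM hk hh hMord hp hBS r₀ hHB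
    rw [← hgauge] at hs
    have hexp_loc : IsGaugeLocal (P.gauge k B) (expNegH H B) := fun φ ψ hT => by
      have hev : IsGaugeLocal (P.gauge k B) (fun φ : (Fin d → ZMod M) → ℝ => eval H B φ) := by
        rw [hgauge]; exact isGaugeLocal_eval h𝔥.ne' hRk.ne' hp hBS H
      simp only [expNegH, hev φ ψ hT]
    have h1 : ContDiff ℝ r₀ (fluct 𝒸 (expNegH H B)) :=
      hS.contDiff_fluct hB.dominated B (P.gauge k B) (Real.exp_pos _).le (hexp_d H) hexp_loc
        (hs.mono_weight (Real.exp_pos _).le hSW)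
    show ContDiff ℝ r₀ (fun φ => fluct 𝒸 (expNegH H B) φ - expNegH (stepOpA (gradCov 𝒸) H) B φ)
    exact h1.sub (hexp_d _)
  -- (2) the product `(e^{−AH} − 1)(e^{−V} − 1)`
  set Pa : ((Fin d → ZMod M) → ℝ) → ℂ := fun ψ => (expNegH AH B ψ - 1) * (expNegH V B ψ - 1) with hPa
  have hAHB : hamNorm (fieldWt h (L : ℝ) d k) ((L : ℝ) ^ k) B.card AH ≤ 1 / 16 := by rw [hcard]; linarith
  have hVB : hamNorm (fieldWt h (L : ℝ) d k) ((L : ℝ) ^ k) B.card V ≤ 1 / 16 := by rw [hcard]; exact hV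
  have hPa_s := tayNormLE_expNegH_sub_one_mul_strong_abkm (R := R) (Mord := Mord) hd hLodd hM hk hh hMord hp
    hBS r₀ hAHB hVB
  rw [← hgauge, hcard] at hPa_s
  have hc2 : 0 ≤ 256 * Real.exp (1 / 4) * hamNorm (fieldWt h (L : ℝ) d k) ((L : ℝ) ^ k) (L ^ (d * k)) AH * nV := by
    positivity
  have hPa_w : TayNormLE (P.gauge k B) r₀ (W.midWeight k B) Pa
      (256 * Real.exp (1 / 4) * hamNorm (fieldWt h (L : ℝ) d k) ((L : ℝ) ^ k) (L ^ (d * k)) AH * nV) :=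
    (hPa_s.mono_weight hc2 hSW).mono_weight hc2 hwm
  have hPa_d : ContDiff ℝ r₀ Pa := (hsub1_d AH).mul (hsub1_d V)
  -- (3) the second-order bracket `e^{−V} − 1 + V`
  set Se : ((Fin d → ZMod M) → ℝ) → ℂ := fun ψ => expNegH V B ψ - 1 + eval V B ψ with hSe
  have hVB8 : hamNorm (fieldWt h (L : ℝ) d k) ((L : ℝ) ^ k) B.card V ≤ 1 / 8 := by rw [hcard]; linarith
  have hSe_s := tayNormLE_expNegH_sub_one_add_strong_abkm (R := R) (Mord := Mord) hd hLodd hM hk hh hMord hp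
    hBS r₀ hVB8
  rw [← hgauge, hcard] at hSe_s
  have hc3 : 0 ≤ 256 * Real.exp (1 / 4) * nV ^ 2 := by positivity
  have hSe_w : TayNormLE (P.gauge k B) r₀ (W.midWeight k B) Se (256 * Real.exp (1 / 4) * nV ^ 2) :=
    (hSe_s.mono_weight hc3 hSW).mono_weight hc3 hwm
  have hSe_d : ContDiff ℝ r₀ Se := (hsub1_d V).add (contDiff_eval V B)
  -- the identity `Φ = D + (−1)•Pa + (−1)•Se`
  have heq : (fun φ => fluctDefect 𝒸 H B φ +
        (expNegH (stepOpA (gradCov 𝒸) H) B φ - 1) * (1 - Complex.exp (-(eval V B φ))) -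
        (Complex.exp (-(eval V B φ)) - 1 + eval V B φ)) =
      fluctDefect 𝒸 H B + ((-1 : ℝ) • Pa + (-1 : ℝ) • Se) := by
    funext φ
    simp only [Pi.add_apply, Pi.smul_apply]
    simp only [neg_one_smul, hPa, hSe, expNegH, hAH]
    ring
  rw [heq]
  have hsum := hD.add (((hPa_w.smul hPa_d (-1)).add (hSe_w.smul hSe_d (-1))) (hPa_d.const_smul (-1 : ℝ))
    (hSe_d.const_smul (-1 : ℝ))) hD_d ((hPa_d.const_smul (-1 : ℝ)).add (hSe_d.const_smul (-1 : ℝ)))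
  refine hsum.mono ?_ (fun φ => (W.midWeight_pos k B φ).le)
  rw [abs_neg, abs_one, one_mul, one_mul]
  have he : 0 ≤ 256 * Real.exp (1 / 4) := by positivity
  have hAV : hamNorm (fieldWt h (L : ℝ) d k) ((L : ℝ) ^ k) (L ^ (d * k)) AH * nV ≤ 2 * nH * nV :=
    mul_le_mul_of_nonneg_right hAH2 hnV0
  nlinarith [mul_le_mul_of_nonneg_left hAV he]

/-- **Lipschitz bound of the block bracket**: on `B = B_x` at scale `k ≤ N` (torus data as in
`tayNormLE_fluctDefect_sub_abkm_of_stepKernelBounds`, `A_𝒫 ≥ 0`), for `‖H‖, ‖H'‖, ‖V‖, ‖V'‖ ≤ 1/64` (scale-`k` coefficient norms):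
`|Φ_B(H,V) − Φ_B(H',V')|_{T_k^{B*}, w_{k:k+1}^B} ≤ 512e^{1/4}(A_𝒫+4)(‖H‖+‖H'‖)‖H−H'‖`
`+ 512e^{1/4}(‖H−H'‖‖V‖ + ‖H'‖‖V−V'‖) + 256e^{1/4}(‖V'‖ + ‖V−V'‖)‖V−V'‖`.
[cite: AdamsBuchholzKoteckyMuller2019, Theorem 6.8 ((6.56), (6.61)–(6.64))] -/
theorem tayNormLE_blockBracket_sub_abkm_of_stepKernelBounds {L N Mord R n p r₀ : ℕ} {θbar lam μ δ₁ δ₀ A𝒫 A𝒫' C₂ h A : ℝ}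
    {𝒞 : ℕ → (Fin d → ZMod M) → ℝ} (hd : 2 ≤ d)
    (hB : AbkmWeightBounds L N Mord R n θbar lam μ δ₁ δ₀ A𝒫 𝒞
      (abkmWeightData L N Mord R θbar (schedDelta δ₀ δ₁ N) 𝒞)) (hA𝒫 : 0 ≤ A𝒫')
    (hLodd : Odd L) (hM : M = L ^ N) {k : ℕ} (hk : k ≤ N)
    {𝒞q : (Fin d → ZMod M) → ℝ} (hS : StepKernelBounds (abkmWeightData L N Mord R θbar (schedDelta δ₀ δ₁ N) 𝒞) L k A𝒫' C₂ 𝒞q) (hδ₀ : 0 < δ₀) (hδ₁ : 0 < δ₁) (hh : 0 < h)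
    (hh0 : hZeroSq d R δ₀ δ₁ ≤ h ^ 2) (hMord : d / 2 + 1 ≤ Mord) (hp : d / 2 + 1 ≤ p)
    (hγ : ∀ q, ((L ^ (d * k) : ℕ) : ℝ) * |gradCov 𝒞q q| ≤ h ^ 2)
    (x : Fin d → ZMod M) {H H' V V' : RelevantHamiltonian ℂ d}
    (hH : hamNorm (fieldWt h (L : ℝ) d k) ((L : ℝ) ^ k) (L ^ (d * k)) H ≤ 1 / 64)
    (hH' : hamNorm (fieldWt h (L : ℝ) d k) ((L : ℝ) ^ k) (L ^ (d * k)) H' ≤ 1 / 64)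
    (hV : hamNorm (fieldWt h (L : ℝ) d k) ((L : ℝ) ^ k) (L ^ (d * k)) V ≤ 1 / 64)
    (hV' : hamNorm (fieldWt h (L : ℝ) d k) ((L : ℝ) ^ k) (L ^ (d * k)) V' ≤ 1 / 64) :
    TayNormLE ((abkmNormParams L N Mord R p r₀ h θbar A (schedDelta δ₀ δ₁ N) 𝒞).gauge k (blockOf (L ^ k) x))
      r₀ ((abkmWeightData L N Mord R θbar (schedDelta δ₀ δ₁ N) 𝒞).midWeight k (blockOf (L ^ k) x))
      (fun φ => (fluctDefect 𝒞q H (blockOf (L ^ k) x) φ +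
          (expNegH (stepOpA (gradCov 𝒞q) H) (blockOf (L ^ k) x) φ - 1) *
            (1 - Complex.exp (-(eval V (blockOf (L ^ k) x) φ))) -
          (Complex.exp (-(eval V (blockOf (L ^ k) x) φ)) - 1 + eval V (blockOf (L ^ k) x) φ)) -
        (fluctDefect 𝒞q H' (blockOf (L ^ k) x) φ +
          (expNegH (stepOpA (gradCov 𝒞q) H') (blockOf (L ^ k) x) φ - 1) *
            (1 - Complex.exp (-(eval V' (blockOf (L ^ k) x) φ))) -
          (Complex.exp (-(eval V' (blockOf (L ^ k) x) φ)) - 1 + eval V' (blockOf (L ^ k) x) φ)))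
      (512 * Real.exp (1 / 4) * (A𝒫' + 4) *
          (hamNorm (fieldWt h (L : ℝ) d k) ((L : ℝ) ^ k) (L ^ (d * k)) H +
            hamNorm (fieldWt h (L : ℝ) d k) ((L : ℝ) ^ k) (L ^ (d * k)) H') *
          hamNorm (fieldWt h (L : ℝ) d k) ((L : ℝ) ^ k) (L ^ (d * k)) (H - H') +
        512 * Real.exp (1 / 4) *
          (hamNorm (fieldWt h (L : ℝ) d k) ((L : ℝ) ^ k) (L ^ (d * k)) (H - H') *
              hamNorm (fieldWt h (L : ℝ) d k) ((L : ℝ) ^ k) (L ^ (d * k)) V +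
            hamNorm (fieldWt h (L : ℝ) d k) ((L : ℝ) ^ k) (L ^ (d * k)) H' *
              hamNorm (fieldWt h (L : ℝ) d k) ((L : ℝ) ^ k) (L ^ (d * k)) (V - V')) +
        256 * Real.exp (1 / 4) *
          (hamNorm (fieldWt h (L : ℝ) d k) ((L : ℝ) ^ k) (L ^ (d * k)) V' +
            hamNorm (fieldWt h (L : ℝ) d k) ((L : ℝ) ^ k) (L ^ (d * k)) (V - V')) *
          hamNorm (fieldWt h (L : ℝ) d k) ((L : ℝ) ^ k) (L ^ (d * k)) (V - V')) := by
  set P := abkmNormParams L N Mord R p r₀ h θbar A (schedDelta δ₀ δ₁ N) 𝒞 with hP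
  set W := abkmWeightData L N Mord R θbar (schedDelta δ₀ δ₁ N) 𝒞 with hW
  set B := blockOf (L ^ k) x with hBdef
  set 𝒸 := 𝒞q with h𝒸
  set AH := stepOpA (gradCov 𝒸) H with hAH
  set AH' := stepOpA (gradCov 𝒸) H' with hAH'
  set Δ := V - V' with hΔ
  set nH := hamNorm (fieldWt h (L : ℝ) d k) ((L : ℝ) ^ k) (L ^ (d * k)) H with hnH
  set nH' := hamNorm (fieldWt h (L : ℝ) d k) ((L : ℝ) ^ k) (L ^ (d * k)) H' with hnH'
  set nHH := hamNorm (fieldWt h (L : ℝ) d k) ((L : ℝ) ^ k) (L ^ (d * k)) (H - H') with hnHH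
  set nV := hamNorm (fieldWt h (L : ℝ) d k) ((L : ℝ) ^ k) (L ^ (d * k)) V with hnV
  set nV' := hamNorm (fieldWt h (L : ℝ) d k) ((L : ℝ) ^ k) (L ^ (d * k)) V' with hnV'
  set nΔ := hamNorm (fieldWt h (L : ℝ) d k) ((L : ℝ) ^ k) (L ^ (d * k)) Δ with hnΔ
  have hL0 : (0 : ℝ) < L := by exact_mod_cast hLodd.pos
  have hL1 : 1 ≤ L := hLodd.pos
  obtain ⟨t, ht⟩ : ∃ t, N = k + t := ⟨N - k, by omega⟩
  have hMt : M = L ^ k * L ^ t := by rw [← pow_add, ← ht]; exact hM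
  have hcard : B.card = L ^ (d * k) := by
    rw [hBdef, card_blockOf hMt hLodd.pow hLodd.pow x, ← pow_mul, mul_comm]
  have h𝔥 : 0 < fieldWt h (L : ℝ) d k := fieldWt_pos hh hL0 d k
  have hRk : (0 : ℝ) < (L : ℝ) ^ k := by positivity
  have hnn : ∀ G : RelevantHamiltonian ℂ d, 0 ≤ hamNorm (fieldWt h (L : ℝ) d k) ((L : ℝ) ^ k) (L ^ (d * k)) G :=
    fun G => hamNorm_nonneg h𝔥.le hRk.le _ _
  have hnH0 : 0 ≤ nH := hnn H
  have hnH'0 : 0 ≤ nH' := hnn H'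
  have hnHH0 : 0 ≤ nHH := hnn (H - H')
  have hnV0 : 0 ≤ nV := hnn V
  have hnV'0 : 0 ≤ nV' := hnn V'
  have hnΔ0 : 0 ≤ nΔ := hnn Δ
  have hnΔle : nΔ ≤ nV + nV' := hamNorm_sub_le h𝔥.le hRk.le _ V V'
  have hnΔ32 : nΔ ≤ 1 / 32 := by linarith
  -- norms of `A H`, `A H'`, `A(H − H')`
  have hAH2 : hamNorm (fieldWt h (L : ℝ) d k) ((L : ℝ) ^ k) (L ^ (d * k)) AH ≤ 2 * nH :=
    hamNorm_stepOpA_abkm_le hd hL1 hh k hγ H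
  have hAH'2 : hamNorm (fieldWt h (L : ℝ) d k) ((L : ℝ) ^ k) (L ^ (d * k)) AH' ≤ 2 * nH' :=
    hamNorm_stepOpA_abkm_le hd hL1 hh k hγ H'
  have hAsub : AH - AH' = stepOpA (gradCov 𝒸) (H - H') := by
    have e := stepOpA_add (gradCov 𝒸) (H - H') H'
    rw [sub_add_cancel] at e
    rw [hAH, hAH', e, add_sub_cancel_right]
  have hAΔ2 : hamNorm (fieldWt h (L : ℝ) d k) ((L : ℝ) ^ k) (L ^ (d * k)) (AH - AH') ≤ 2 * nHH := by
    rw [hAsub]; exact hamNorm_stepOpA_abkm_le hd hL1 hh k hγ (H - H')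
  have hBS : B ⊆ thicken (P.rad k) B := subset_thicken _ _
  have hgauge : P.gauge k B = fieldGauge (fieldWt h (L : ℝ) d k) ((L : ℝ) ^ k) p (thicken (P.rad k) B) := rfl
  -- weights: strong ≤ weak ≤ mid
  have hSW : ∀ φ, expWeight (strongCoef h N k • derivForm (L : ℝ) k (diffIndex d Mord)
      (boxDensity (boxRad R L k) (boxWt (L : ℝ) d k) B)) φ ≤ W.weight k B φ :=
    fun φ => strongWeight_le_weight_abkm hB hδ₀ hδ₁ hh hh0 k (subset_refl B) φ
  have hwm : ∀ φ, W.weight k B φ ≤ W.midWeight k B φ := fun φ =>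
    WeightData.weight_le_midWeight hB.dominated k B φ
  have hexp_d : ∀ G : RelevantHamiltonian ℂ d, ContDiff ℝ r₀ (expNegH G B) := fun G => by
    show ContDiff ℝ r₀ (fun φ : (Fin d → ZMod M) → ℝ => Complex.exp (-(eval G B φ)))
    exact (contDiff_eval G B (n := r₀)).neg.cexp
  have hsub1_d : ∀ G : RelevantHamiltonian ℂ d, ContDiff ℝ r₀ (fun φ => expNegH G B φ - 1) :=
    fun G => (hexp_d G).sub contDiff_const
  -- (1) the defect difference
  have hD := tayNormLE_fluctDefect_sub_abkm_of_stepKernelBounds (p := p) (r₀ := r₀) (A := A) hd hB hA𝒫 hLodd hM hk hS hδ₀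
    hδ₁ hh hh0 hMord hp hγ x hH hH'
  have hD_d : ∀ G : RelevantHamiltonian ℂ d, hamNorm (fieldWt h (L : ℝ) d k) ((L : ℝ) ^ k) (L ^ (d * k)) G ≤ 1 / 8 →
      ContDiff ℝ r₀ (fluctDefect 𝒸 G B) := by
    intro G hG
    have hGB : hamNorm (fieldWt h (L : ℝ) d k) ((L : ℝ) ^ k) B.card G ≤ 1 / 8 := by rw [hcard]; exact hG
    have hs := tayNormLE_expNegH_strong_abkm (R := R) (Mord := Mord) hd hLodd hM hk hh hMord hp hBS r₀ hGB
    rw [← hgauge] at hs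
    have hexp_loc : IsGaugeLocal (P.gauge k B) (expNegH G B) := fun φ ψ hT => by
      have hev : IsGaugeLocal (P.gauge k B) (fun φ : (Fin d → ZMod M) → ℝ => eval G B φ) := by
        rw [hgauge]; exact isGaugeLocal_eval h𝔥.ne' hRk.ne' hp hBS G
      simp only [expNegH, hev φ ψ hT]
    have h1 : ContDiff ℝ r₀ (fluct 𝒸 (expNegH G B)) :=
      hS.contDiff_fluct hB.dominated B (P.gauge k B) (Real.exp_pos _).le (hexp_d G) hexp_loc
        (hs.mono_weight (Real.exp_pos _).le hSW)
    show ContDiff ℝ r₀ (fun φ => fluct 𝒸 (expNegH G B) φ - expNegH (stepOpA (gradCov 𝒸) G) B φ)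
    exact h1.sub (hexp_d _)
  have hDd : ContDiff ℝ r₀ (fun φ => fluctDefect 𝒸 H B φ - fluctDefect 𝒸 H' B φ) :=
    (hD_d H (by linarith)).sub (hD_d H' (by linarith))
  -- (2) the mixed atom `(e^{−AH} − e^{−AH'})(e^{−V} − 1)`
  set M₁ : ((Fin d → ZMod M) → ℝ) → ℂ := fun ψ => (expNegH AH B ψ - expNegH AH' B ψ) * (expNegH V B ψ - 1)
    with hM₁
  have hM₁_s := tayNormLE_expNegH_sub_mul_sub_one_strong_abkm (R := R) (Mord := Mord) hd hLodd hM hk hh hMord hp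
    hBS r₀ (H₁ := AH) (H₂ := AH') (H₃ := V) (by rw [hcard]; linarith) (by rw [hcard]; linarith)
    (by rw [hcard]; linarith)
  rw [← hgauge, hcard] at hM₁_s
  have hc₁ : 0 ≤ 256 * Real.exp (1 / 4) * hamNorm (fieldWt h (L : ℝ) d k) ((L : ℝ) ^ k) (L ^ (d * k)) (AH - AH') *
      nV := by
    have := hnn (AH - AH'); positivity
  have hM₁_w : TayNormLE (P.gauge k B) r₀ (W.midWeight k B) M₁
      (256 * Real.exp (1 / 4) * hamNorm (fieldWt h (L : ℝ) d k) ((L : ℝ) ^ k) (L ^ (d * k)) (AH - AH') * nV) :=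
    (hM₁_s.mono_weight hc₁ hSW).mono_weight hc₁ hwm
  have hM₁_d : ContDiff ℝ r₀ M₁ := ((hexp_d AH).sub (hexp_d AH')).mul (hsub1_d V)
  -- (3) the mixed atom `(e^{−V} − e^{−V'})(e^{−AH'} − 1)`
  set M₂ : ((Fin d → ZMod M) → ℝ) → ℂ := fun ψ => (expNegH V B ψ - expNegH V' B ψ) * (expNegH AH' B ψ - 1)
    with hM₂
  have hM₂_s := tayNormLE_expNegH_sub_mul_sub_one_strong_abkm (R := R) (Mord := Mord) hd hLodd hM hk hh hMord hp
    hBS r₀ (H₁ := V) (H₂ := V') (H₃ := AH') (by rw [hcard]; linarith) (by rw [hcard]; linarith)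
    (by rw [hcard]; linarith)
  rw [← hgauge, hcard] at hM₂_s
  have hc₂ : 0 ≤ 256 * Real.exp (1 / 4) * nΔ * hamNorm (fieldWt h (L : ℝ) d k) ((L : ℝ) ^ k) (L ^ (d * k)) AH' := by
    have := hnn AH'; positivity
  have hM₂_w : TayNormLE (P.gauge k B) r₀ (W.midWeight k B) M₂
      (256 * Real.exp (1 / 4) * nΔ * hamNorm (fieldWt h (L : ℝ) d k) ((L : ℝ) ^ k) (L ^ (d * k)) AH') :=
    (hM₂_s.mono_weight hc₂ hSW).mono_weight hc₂ hwm
  have hM₂_d : ContDiff ℝ r₀ M₂ := ((hexp_d V).sub (hexp_d V')).mul (hsub1_d AH')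
  -- (4) the product `(e^{−V'} − 1)(e^{−Δ} − 1)`
  set Pr : ((Fin d → ZMod M) → ℝ) → ℂ := fun ψ => (expNegH V' B ψ - 1) * (expNegH Δ B ψ - 1) with hPr
  have hPr_s := tayNormLE_expNegH_sub_one_mul_strong_abkm (R := R) (Mord := Mord) hd hLodd hM hk hh hMord hp
    hBS r₀ (H₁ := V') (H₂ := Δ) (by rw [hcard]; linarith) (by rw [hcard]; linarith)
  rw [← hgauge, hcard] at hPr_s
  have hc₃ : 0 ≤ 256 * Real.exp (1 / 4) * nV' * nΔ := by positivity
  have hPr_w : TayNormLE (P.gauge k B) r₀ (W.midWeight k B) Pr (256 * Real.exp (1 / 4) * nV' * nΔ) :=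
    (hPr_s.mono_weight hc₃ hSW).mono_weight hc₃ hwm
  have hPr_d : ContDiff ℝ r₀ Pr := (hsub1_d V').mul (hsub1_d Δ)
  -- (5) the second-order bracket of `Δ`
  set Se : ((Fin d → ZMod M) → ℝ) → ℂ := fun ψ => expNegH Δ B ψ - 1 + eval Δ B ψ with hSe
  have hSe_s := tayNormLE_expNegH_sub_one_add_strong_abkm (R := R) (Mord := Mord) hd hLodd hM hk hh hMord hp
    hBS r₀ (H := Δ) (by rw [hcard]; linarith)
  rw [← hgauge, hcard] at hSe_s
  have hc₄ : 0 ≤ 256 * Real.exp (1 / 4) * nΔ ^ 2 := by positivity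
  have hSe_w : TayNormLE (P.gauge k B) r₀ (W.midWeight k B) Se (256 * Real.exp (1 / 4) * nΔ ^ 2) :=
    (hSe_s.mono_weight hc₄ hSW).mono_weight hc₄ hwm
  have hSe_d : ContDiff ℝ r₀ Se := (hsub1_d Δ).add (contDiff_eval Δ B)
  -- the pointwise identity
  have hVsum : V = V' + Δ := by rw [hΔ]; abel
  have heq : (fun φ => (fluctDefect 𝒸 H B φ +
          (expNegH (stepOpA (gradCov 𝒸) H) B φ - 1) * (1 - Complex.exp (-(eval V B φ))) -
          (Complex.exp (-(eval V B φ)) - 1 + eval V B φ)) -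
        (fluctDefect 𝒸 H' B φ +
          (expNegH (stepOpA (gradCov 𝒸) H') B φ - 1) * (1 - Complex.exp (-(eval V' B φ))) -
          (Complex.exp (-(eval V' B φ)) - 1 + eval V' B φ))) =
      (fun φ => fluctDefect 𝒸 H B φ - fluctDefect 𝒸 H' B φ) +
        (((-1 : ℝ) • M₁ + (-1 : ℝ) • M₂) + ((-1 : ℝ) • Pr + (-1 : ℝ) • Se)) := by
    funext φ
    simp only [Pi.add_apply, Pi.smul_apply]
    simp only [neg_one_smul, hM₁, hM₂, hPr, hSe, expNegH, hAH, hAH']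
    have hfacV : Complex.exp (-(eval V B φ)) = Complex.exp (-(eval V' B φ)) * Complex.exp (-(eval Δ B φ)) := by
      rw [hVsum, eval_add, neg_add, Complex.exp_add]
    have heV : eval V B φ = eval V' B φ + eval Δ B φ := by rw [hVsum, eval_add]
    rw [hfacV, heV]
    ring
  rw [heq]
  -- combine
  have h23 := (hM₁_w.smul hM₁_d (-1)).add (hM₂_w.smul hM₂_d (-1)) (hM₁_d.const_smul (-1 : ℝ))
    (hM₂_d.const_smul (-1 : ℝ))
  have h45 := (hPr_w.smul hPr_d (-1)).add (hSe_w.smul hSe_d (-1)) (hPr_d.const_smul (-1 : ℝ))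
    (hSe_d.const_smul (-1 : ℝ))
  have h2345 := h23.add h45 ((hM₁_d.const_smul (-1 : ℝ)).add (hM₂_d.const_smul (-1 : ℝ)))
    ((hPr_d.const_smul (-1 : ℝ)).add (hSe_d.const_smul (-1 : ℝ)))
  have hsum := hD.add h2345 hDd (((hM₁_d.const_smul (-1 : ℝ)).add (hM₂_d.const_smul (-1 : ℝ))).add
    ((hPr_d.const_smul (-1 : ℝ)).add (hSe_d.const_smul (-1 : ℝ))))
  refine hsum.mono ?_ (fun φ => (W.midWeight_pos k B φ).le)
  simp only [abs_neg, abs_one, one_mul]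
  have he : 0 ≤ 256 * Real.exp (1 / 4) := by positivity
  have hb1 : hamNorm (fieldWt h (L : ℝ) d k) ((L : ℝ) ^ k) (L ^ (d * k)) (AH - AH') * nV ≤ 2 * nHH * nV :=
    mul_le_mul_of_nonneg_right hAΔ2 hnV0
  have hb2 : nΔ * hamNorm (fieldWt h (L : ℝ) d k) ((L : ℝ) ^ k) (L ^ (d * k)) AH' ≤ nΔ * (2 * nH') :=
    mul_le_mul_of_nonneg_left hAH'2 hnΔ0
  have hsq : nΔ ^ 2 = nΔ * nΔ := sq nΔ
  nlinarith [mul_le_mul_of_nonneg_left hb1 he, mul_le_mul_of_nonneg_left hb2 he, mul_nonneg he (mul_nonneg hnV'0 hnΔ0),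
    mul_nonneg he (mul_nonneg hnΔ0 hnΔ0)]

end Literature.MathematicalPhysics.StatisticalMechanics.GradientRG

end
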